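import Summits.MatrixMultiplication.MatrixMultiplication.Theorems.EisensteinValCertificatesHomocyclicSTPPDesignsUniversalityGlue
import Summits.MatrixMultiplication.MatrixMultiplication.Theorems.EisensteinValCertificatesHomocyclicSTPPDesignsRankPackingBound
import Summits.MatrixMultiplication.MatrixMultiplication.Theorems.EisensteinValCertificatesHomocyclicSTPPDesignsRankPresentation

set_option linter.dupNamespace false
-- (single-conjunct summit: the namespace repeats `MatrixMultiplication`)

/-!
# Cyclic reduction for abelian STPP designs: `CThesis ↔ HomocyclicSTPPDesigns ↔ AutomaticPackingThesis`

Route `EisensteinValCertificates`, crux `HomocyclicSTPPDesigns` = X′ (stmt-MatrixMultiplication-10647).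
ASSEMBLY of the universality programme (crux strategist gen 2 + line lead c5, 2026-08-17), now
UNCONDITIONAL: the two hypotheses of the landed glue `HomocyclicSTPPDesigns_of_subs`
(`…UniversalityGlue.lean`, p165875) are the landed stubs `stub_rankPackingBound` (rank-form slice-rank
packing bound, `…RankPackingBound.lean`, p166903) and `stub_rankPresentation` (rank presentation,
`…RankPresentation.lean`, p167561).  Consequences, all sorry-free:

* `homocyclicSTPPDesigns_of_cThesis : CThesis → HomocyclicSTPPDesigns` — an STPP family beating `2+ε`
  in ANY finite abelian group yields one in a prime cyclic group `ℤ/P` (= `(ℤ/P)^1`): the design-level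
  cyclic reduction (the question behind Pratt 2024 Rem. 4.6), by the forced slice-rank margin
  `e^{66δ·rank}` paying the mixed-radix Freiman embedding `3^{rank}`;
* `cThesis_iff_homocyclicSTPPDesigns` (registered stub) — **X_C ↔ X′**: the deciding cruxes of routes
  GroupTheoreticSTPP (`CThesis`, stmt-MatrixMultiplication-0593) and EisensteinValCertificates
  (X′, stmt-10647) are ONE statement; with the landed U1 (`homocyclicSTPPDesigns_iff_automaticPackingThesis`)
  also `cThesis_iff_automaticPackingThesis` — **X_C ↔ X_aut** (AutomaticSTPPDesigns, stmt-7356);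
* kill sides: `noHomocyclicSTPP_iff_cAbelianObstructionNeg` — `NoHomocyclicSTPP` (stmt-7787) `↔`
  `CAbelianObstructionNeg` (GroupTheoreticSTPP's negative crux: BCCGNSU Thm B WITHOUT the
  bounded-exponent hypothesis), and both `↔` the uniform cyclic packing ceiling
  (`noHomocyclicSTPP_iff_uniformCyclicGap`, landed).

So the abelian group-theoretic approach reaches `ω = 2` through SOME finite abelian group iff it does
through prime cyclic groups, iff through homocyclic `(ℤ/q)^ℓ`; and an obstruction for cyclic groups of
prime order with a uniform exponent is an obstruction for all finite abelian groups.

Sources: Blasiak–Church–Cohn–Grochow–Naslund–Sawin–Umans 2017 (Thm A′, Thm 4.14, §3.2);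
K. Pratt, ITCS 2024 = arXiv:2309.03878 (proofs of Thm 4.4 / 4.7, Rem. 4.6); Cohn–Kleinberg–Szegedy–Umans
2005 (STPP, Thm 5.5).  No new mathematics in this file: composition of landed theorems.
-/

namespace Summit.MatrixMultiplication.MatrixMultiplication.Theorems.HomocyclicSTPPDesigns.Universality

open Summit.MatrixMultiplication.MatrixMultiplication.Theses.EisensteinValCertificates
  (HomocyclicSTPPDesigns NoHomocyclicSTPP)
open Summit.MatrixMultiplication.MatrixMultiplication.Theses.GroupTheoreticSTPP
  (CThesis CAbelianObstructionNeg)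
open Summit.MatrixMultiplication.MatrixMultiplication.Theses.AutomaticSTPPDesigns (AutomaticPackingThesis)

/-- **Cyclic reduction (unconditional).** `CThesis → HomocyclicSTPPDesigns`: an STPP family beating
`2 + ε` in any finite abelian group gives one in some prime cyclic group `(ℤ/P)^1`
(`HomocyclicSTPPDesigns_of_subs` fed with the landed `stub_rankPackingBound` and
`stub_rankPresentation`). [cite: BlasiakChurchCohnGrochowNaslundSawinUmans2017, Thm. 4.14 and §3.2]
[cite: Pratt2024, Thm. 4.4 (proof)] -/
theorem homocyclicSTPPDesigns_of_cThesis (hC : CThesis) : HomocyclicSTPPDesigns :=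
  HomocyclicSTPPDesigns_of_subs hC
    (fun p _ n r hr G' _ _ _ K _ _ _ hK N A B C hS =>
      stub_rankPackingBound p n r hr G' K hK N A B C hS)
    (fun H _ _ hH => stub_rankPresentation H hH)

/-- **X_C ↔ X′** (registered stub `cThesis_iff_homocyclicSTPPDesigns`): the deciding crux of route
GroupTheoreticSTPP (`CThesis`, stmt-MatrixMultiplication-0593: STPP designs in arbitrary finite abelian
groups beating every `2+ε`) is EQUIVALENT to the deciding crux of route EisensteinValCertificates
(`HomocyclicSTPPDesigns`, stmt-10647).  `→` is the cyclic reduction above; `←` is the landed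
`cThesis_of_homocyclicSTPPDesigns` (p149874). -/
theorem cThesis_iff_homocyclicSTPPDesigns :
    Summit.MatrixMultiplication.MatrixMultiplication.Theses.GroupTheoreticSTPP.CThesis ↔
      HomocyclicSTPPDesigns :=
  cThesis_iff_homocyclic_of_glue homocyclicSTPPDesigns_of_cThesis

/-- **X_C ↔ X_aut**: `CThesis` (GroupTheoreticSTPP, stmt-0593) is equivalent to
`AutomaticPackingThesis` (AutomaticSTPPDesigns, stmt-7356), through X′ (U1, landed
`homocyclicSTPPDesigns_iff_automaticPackingThesis`). -/
theorem cThesis_iff_automaticPackingThesis : CThesis ↔ AutomaticPackingThesis :=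
  cThesis_iff_homocyclicSTPPDesigns.trans homocyclicSTPPDesigns_iff_automaticPackingThesis

/-- **Kill sides coincide (unconditional).** The route's negative milestone `NoHomocyclicSTPP`
(stmt-7787) is equivalent to GroupTheoreticSTPP's negative crux `CAbelianObstructionNeg` (BCCGNSU 2017
Thm B without the bounded-exponent hypothesis): a uniform-`ε` obstruction for the prime-power
homocyclic hosts is one for ALL finite abelian groups. -/
theorem noHomocyclicSTPP_iff_cAbelianObstructionNeg : NoHomocyclicSTPP ↔ CAbelianObstructionNeg :=
  noHomocyclic_iff_cAbelianObstructionNeg_of_universality homocyclicSTPPDesigns_of_cThesis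

/-- The three deciding statements and their packaging: `CThesis ↔ X′`, `X′ ↔ X_aut`,
`¬X′-side: NoHomocyclicSTPP ↔ CAbelianObstructionNeg`. -/
theorem universality_package :
    (CThesis ↔ HomocyclicSTPPDesigns) ∧ (HomocyclicSTPPDesigns ↔ AutomaticPackingThesis) ∧
      (NoHomocyclicSTPP ↔ CAbelianObstructionNeg) :=
  ⟨cThesis_iff_homocyclicSTPPDesigns, homocyclicSTPPDesigns_iff_automaticPackingThesis,
    noHomocyclicSTPP_iff_cAbelianObstructionNeg⟩

end Summit.MatrixMultiplication.MatrixMultiplication.Theorems.HomocyclicSTPPDesigns.Universality
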